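import Mathlib.MeasureTheory.Integral.Bochner.Basic
import Mathlib.MeasureTheory.Integral.Bochner.ContinuousLinearMap
import Mathlib.Analysis.Calculus.LineDeriv.IntegrationByParts
import Mathlib.MeasureTheory.Measure.Haar.InnerProductSpace
import Literature.Analysis.FluidPDE.StationaryEulerPotentials
import Literature.Analysis.FluidPDE.StationaryEulerLaminates
import HarnessLib

/-!
# Wave packets: finite sums of localized plane waves, rescaling, cutoff expansion
(Choffrut–Székelyhidi 2014, Lemma 3–4, Prop. 6)

Topic `Literature/Analysis/FluidPDE`. Support file of the proof of
`Literature.Analysis.FluidPDE.Torus.ChoffrutSzekelyhidi2014_thm1` (Choffrut–Székelyhidi, SIAM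
J. Math. Anal. 46 (2014) = arXiv:1401.4301). Bookkeeping around the operator `𝓛_w̄` of
`StationaryEulerPotentials.lean`, as needed by the two-state oscillation (Lemma 4) and the
realization of laminates (Prop. 6):

* `WaveTerm` (a certificate with a smooth compactly supported potential) and `Packet`s
  (finite lists of terms); the field of a packet is smooth, compactly supported, admissible, and
  has integral zero (each coordinate is a second derivative of a compactly supported function);
* **rescaling** `φ ↦ s² φ((· - x₀)/s)`, under which `𝓛_w̄[φ]` is transported:
  `field (rescale x₀ s φ) x = field φ ((x - x₀)/s)` (homogeneity of order two);
* the **cutoff expansion** (used in the proof of Lemma 4):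
  `𝓛_w̄[χ · G(⟪η,·⟫)] = χ G''(⟪η,·⟫) w̄ + R` with an explicit remainder `R` that vanishes
  wherever `∇χ = ∇²χ = 0` and is bounded by `C_w̄ (M₂ |G| + 2 M₁ |η| |G'|)` in terms of bounds
  `M₁, M₂` on the first and second derivatives of `χ`.

## References

* A. Choffrut, L. Székelyhidi Jr., SIAM J. Math. Anal. 46 (2014), Lemma 3, Lemma 4, Prop. 6.
-/

noncomputable section

open scoped InnerProductSpace Matrix ContDiff
open Set Function MeasureTheory

namespace Literature.Analysis.FluidPDE

namespace StationaryEuler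

variable {d : Type*} [Fintype d] [DecidableEq d]

/-! ## Norm bookkeeping on the state space -/

omit [DecidableEq d] in
/-- `‖w‖ ≤ Σ_κ |w_κ|` on the (Euclidean) state space. [folklore] -/
theorem norm_le_sum_abs (w : State d) : ‖w‖ ≤ ∑ κ, |w κ| := by
  have h : ‖w‖ ^ 2 ≤ (∑ κ, |w κ|) ^ 2 := by
    rw [EuclideanSpace.norm_sq_eq]
    simp only [Real.norm_eq_abs]
    exact Finset.sum_sq_le_sq_sum_of_nonneg fun κ _ => abs_nonneg _
  exact le_of_sq_le_sq h (Finset.sum_nonneg fun κ _ => abs_nonneg _)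

/-! ## Integral of the field -/

namespace WaveCert

variable (c : WaveCert d)

omit [DecidableEq d] in
/-- `∫ ∂_v f = 0` for compactly supported `C¹` functions on `ℝ^d`. [folklore] -/
theorem integral_pd_eq_zero {f : Ed d → ℝ} (hf : ContDiff ℝ 1 f) (hfc : HasCompactSupport f)
    (v : Ed d) : ∫ x, pd v f x = 0 := by
  have h1 : Integrable (fun x => fderiv ℝ f x v * (1 : ℝ)) := by
    simp only [mul_one]
    exact (continuous_pd hf v).integrable_of_hasCompactSupport (hasCompactSupport_pd hfc v)
  have h2 : Integrable (fun x => f x * fderiv ℝ (fun _ : Ed d => (1 : ℝ)) x v) := by simp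
  have h3 : Integrable (fun x => f x * (1 : ℝ)) := by
    simp only [mul_one]
    exact hf.continuous.integrable_of_hasCompactSupport hfc
  have := integral_mul_fderiv_eq_neg_fderiv_mul_of_integrable (μ := (volume : Measure (Ed d)))
    h1 h2 h3 (fun x _ => hf.differentiable one_ne_zero x) (fun x _ => differentiableAt_const _)
  simp only [mul_one] at this
  simpa [pd] using this

/-- Each coordinate of `𝓛_w̄[φ]` has integral zero (it is a derivative of a compactly
supported function). [cite: ChoffrutSzekelyhidi2014, Lemma 3] -/
theorem integral_field_apply {φ : Ed d → ℝ} (hφ : ContDiff ℝ ∞ φ) (hφc : HasCompactSupport φ)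
    (κ : Idx d) : ∫ x, c.field φ x κ = 0 := by
  have hint : ∀ k l, ∫ x, pd (eb k) (pd (eb l) φ) x = 0 := fun k l =>
    integral_pd_eq_zero ((contDiff_pd hφ _).of_le one_le_infty') (hasCompactSupport_pd hφc _) _
  have hi : ∀ k l, Integrable fun x => pd (eb k) (pd (eb l) φ) x := fun k l =>
    (contDiff_pd_pd hφ _ _).continuous.integrable_of_hasCompactSupport
      (hasCompactSupport_pd (hasCompactSupport_pd hφc _) _)
  have hS : ∀ i j, ∫ x, c.strS φ i j x = 0 := by
    intro i j
    simp only [strS]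
    rw [integral_finsetSum _ fun k _ => ?_]
    · refine Finset.sum_eq_zero fun k _ => ?_
      rw [integral_finsetSum _ fun l _ => (hi k l).const_mul _]
      refine Finset.sum_eq_zero fun l _ => ?_
      rw [integral_const_mul, hint, mul_zero]
    · exact integrable_finsetSum _ fun l _ => (hi k l).const_mul _
  rcases κ with i | ⟨i, j⟩
  · simp only [field_apply_inl, velPot]
    rw [integral_finsetSum _ fun k _ => ?_]
    · refine Finset.sum_eq_zero fun k _ => ?_
      rw [integral_finsetSum _ fun l _ => (hi k l).const_mul _]
      refine Finset.sum_eq_zero fun l _ => ?_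
      rw [integral_const_mul, hint, mul_zero]
    · exact integrable_finsetSum _ fun l _ => (hi k l).const_mul _
  · simp only [field_apply_inr, strPot]
    have hiS : ∀ i j, Integrable fun x => c.strS φ i j x := fun i j =>
      (c.contDiff_strS hφ i j).continuous.integrable_of_hasCompactSupport <|
        IsCompact.of_isClosed_subset hφc (isClosed_tsupport _) <|
          closure_minimal (fun x hx => by
            by_contra h
            exact hx (by simp only [strS]; simp [pd_pd_eq_zero_of_notMem h])) (isClosed_tsupport φ)
    rw [integral_sub (hiS i j), hS]
    · split_ifs
      · rw [integral_div, integral_finsetSum _ fun m _ => hiS m m]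
        simp [hS]
      · simp
    · split_ifs
      · exact (integrable_finsetSum _ fun m _ => hiS m m).div_const _
      · exact integrable_zero _ _ _

/-- The field has integral zero. [cite: ChoffrutSzekelyhidi2014, Lemma 3] -/
theorem integral_field {φ : Ed d → ℝ} (hφ : ContDiff ℝ ∞ φ) (hφc : HasCompactSupport φ) :
    ∫ x, c.field φ x = 0 := by
  have hint : Integrable (c.field φ) :=
    (c.continuous_field hφ).integrable_of_hasCompactSupport (c.hasCompactSupport_field hφc)
  ext κ
  have h := (PiLp.proj 2 (𝕜 := ℝ) (fun _ : Idx d => ℝ) κ).integral_comp_comm hint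
  simp only [PiLp.proj_apply] at h
  change (∫ x, c.field φ x) κ = 0
  rw [← h]
  exact c.integral_field_apply hφ hφc κ

/-! ## Rescaling -/

/-- The rescaled potential `s² φ((x - x₀)/s)` placed on a cube of side `s` at `x₀`.
[cite: ChoffrutSzekelyhidi2014, §2, Step 3 ("covering and rescaling")] -/
def rescale (x₀ : Ed d) (s : ℝ) (φ : Ed d → ℝ) : Ed d → ℝ := fun x => s ^ 2 * φ (s⁻¹ • (x - x₀))

omit [DecidableEq d] in
/-- Rescaled potentials are smooth. [folklore] -/
theorem contDiff_rescale {φ : Ed d → ℝ} (hφ : ContDiff ℝ ∞ φ) (x₀ : Ed d) (s : ℝ) :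
    ContDiff ℝ ∞ (rescale x₀ s φ) := by
  unfold rescale; fun_prop

omit [DecidableEq d] in
/-- First derivatives of rescaled potentials. [folklore] -/
theorem pd_rescale {φ : Ed d → ℝ} (hφ : ContDiff ℝ ∞ φ) (x₀ : Ed d) {s : ℝ} (v : Ed d) :
    pd v (rescale x₀ s φ) = fun x => s ^ 2 * (s⁻¹ * pd v φ (s⁻¹ • (x - x₀))) := by
  have hA : ∀ x, HasFDerivAt (fun x : Ed d => s⁻¹ • (x - x₀)) (s⁻¹ • ContinuousLinearMap.id ℝ (Ed d)) x :=
    fun x => ((hasFDerivAt_id x).sub_const x₀).const_smul s⁻¹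
  have hφd := differentiable_of_smooth hφ
  funext x
  have hcomp : HasFDerivAt (rescale x₀ s φ)
      (s ^ 2 • (fderiv ℝ φ (s⁻¹ • (x - x₀))).comp (s⁻¹ • ContinuousLinearMap.id ℝ (Ed d))) x :=
    ((hφd _).hasFDerivAt.comp x (hA x)).const_smul (s ^ 2)
  rw [pd_apply, hcomp.fderiv]
  simp [pd_apply, smul_eq_mul]

omit [DecidableEq d] in
/-- Second derivatives of rescaled potentials: homogeneity of order two. [folklore] -/
theorem pd_pd_rescale {φ : Ed d → ℝ} (hφ : ContDiff ℝ ∞ φ) (x₀ : Ed d) {s : ℝ} (hs : s ≠ 0)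
    (a b : Ed d) : pd a (pd b (rescale x₀ s φ)) = fun x => pd a (pd b φ) (s⁻¹ • (x - x₀)) := by
  rw [pd_rescale hφ]
  have h1 : (fun x => s ^ 2 * (s⁻¹ * pd b φ (s⁻¹ • (x - x₀)))) = rescale x₀ s (fun y => s⁻¹ * pd b φ y) := by
    funext x; rfl
  rw [h1, pd_rescale ((contDiff_const).mul (contDiff_pd hφ b)), pd_const_mul
    (differentiable_of_smooth (contDiff_pd hφ b))]
  funext x
  field_simp

/-- **Transport of `𝓛_w̄` under rescaling**: `𝓛_w̄[s² φ((·-x₀)/s)](x) = 𝓛_w̄[φ]((x-x₀)/s)`.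
[cite: ChoffrutSzekelyhidi2014, §2, Step 3] -/
theorem field_rescale {φ : Ed d → ℝ} (hφ : ContDiff ℝ ∞ φ) (x₀ : Ed d) {s : ℝ} (hs : s ≠ 0)
    (x : Ed d) : c.field (rescale x₀ s φ) x = c.field φ (s⁻¹ • (x - x₀)) := by
  have key : ∀ k l, pd (eb k) (pd (eb l) (rescale x₀ s φ)) x = pd (eb k) (pd (eb l) φ) (s⁻¹ • (x - x₀)) :=
    fun k l => congrFun (pd_pd_rescale hφ x₀ hs _ _) x
  have hv : ∀ i, c.velPot (rescale x₀ s φ) i x = c.velPot φ i (s⁻¹ • (x - x₀)) := fun i => by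
    simp only [velPot, key]
  have hs' : ∀ i j, c.strS (rescale x₀ s φ) i j x = c.strS φ i j (s⁻¹ • (x - x₀)) := fun i j => by
    simp only [strS, key]
  have hu : ∀ i j, c.strPot (rescale x₀ s φ) i j x = c.strPot φ i j (s⁻¹ • (x - x₀)) := fun i j => by
    simp only [strPot, hs']
  ext κ; rcases κ with i | ⟨i, j⟩
  · simp only [field_apply_inl, hv]
  · simp only [field_apply_inr, hu]

omit [DecidableEq d] in
/-- Support of a rescaled potential. [folklore] -/
theorem tsupport_rescale_subset (φ : Ed d → ℝ) (x₀ : Ed d) {s : ℝ} (hs : s ≠ 0) :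
    tsupport (rescale x₀ s φ) ⊆ (fun y => x₀ + s • y) '' tsupport φ := by
  have hhom : (fun y : Ed d => x₀ + s • y) = (Homeomorph.smulOfNeZero s hs).trans (Homeomorph.addLeft x₀) := by
    funext y; simp [Homeomorph.smulOfNeZero]
  have hsupp : support (rescale x₀ s φ) ⊆ (fun y => x₀ + s • y) '' support φ := by
    intro x hx
    refine ⟨s⁻¹ • (x - x₀), fun h => hx ?_, by simp [smul_smul, mul_inv_cancel₀ hs]⟩
    simp [rescale, h]
  rw [hhom] at hsupp ⊢
  calc tsupport (rescale x₀ s φ) = closure (support (rescale x₀ s φ)) := rfl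
    _ ⊆ closure (((Homeomorph.smulOfNeZero s hs).trans (Homeomorph.addLeft x₀)) '' support φ) :=
        closure_mono hsupp
    _ = ((Homeomorph.smulOfNeZero s hs).trans (Homeomorph.addLeft x₀)) '' tsupport φ :=
        (Homeomorph.image_closure _ _).symm

omit [DecidableEq d] in
/-- Rescaled potentials have compact support. [folklore] -/
theorem hasCompactSupport_rescale {φ : Ed d → ℝ} (hφc : HasCompactSupport φ) (x₀ : Ed d) {s : ℝ}
    (hs : s ≠ 0) : HasCompactSupport (rescale x₀ s φ) :=
  IsCompact.of_isClosed_subset (hφc.image (by fun_prop)) (isClosed_tsupport _)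
    (tsupport_rescale_subset φ x₀ hs)

/-! ## The cutoff expansion -/

/-- The remainder of the cutoff expansion, coordinate by coordinate: the terms of
`Σ_{kl} A_{kl} ∂_k∂_l(χ g)` in which at least one derivative falls on `χ`
(`g = G(⟪η,·⟫)`, `∂_k g = η_k G'`, so these are
`A_{kl} [(∂_k∂_l χ) G + (∂_l χ η_k + ∂_k χ η_l) G']`). [cite: ChoffrutSzekelyhidi2014, Lemma 4] -/
def remTerm (A : d → d → ℝ) (χ : Ed d → ℝ) (G : ℝ → ℝ) (x : Ed d) : ℝ :=
  ∑ k, ∑ l, A k l * (pd (eb k) (pd (eb l) χ) x * G (phase c.η x) +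
    (pd (eb l) χ x * c.η k + pd (eb k) χ x * c.η l) * deriv G (phase c.η x))

/-- The stress coefficients of `strPot`: `Q_{ijkl} = Φ_{ikjl} - δ_{ij} (Σ_m Φ_{mkml})/d`. [folklore] -/
def Q (i j k l : d) : ℝ := c.Φ i k j l - if i = j then (∑ m, c.Φ m k m l) / Fintype.card d else 0

/-- `strPot` as a double sum with the coefficients `Q`. [folklore] -/
theorem strPot_eq_sum (φ : Ed d → ℝ) (i j : d) (x : Ed d) :
    c.strPot φ i j x = ∑ k, ∑ l, c.Q i j k l * pd (eb k) (pd (eb l) φ) x := by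
  unfold strPot Q strS
  split_ifs with h
  · simp only [sub_mul, Finset.sum_sub_distrib, div_mul_eq_mul_div, Finset.sum_div, Finset.sum_mul]
    congr 1
    rw [Finset.sum_comm]
    refine Finset.sum_congr rfl fun k _ => ?_
    rw [Finset.sum_comm]
  · simp

/-- The remainder field of the cutoff expansion. [cite: ChoffrutSzekelyhidi2014, Lemma 4] -/
def rem (χ : Ed d → ℝ) (G : ℝ → ℝ) (x : Ed d) : State d :=
  mkSt (WithLp.toLp 2 fun i => c.remTerm (c.P i) χ G x)
    (Matrix.of fun i j => c.remTerm (c.Q i j) χ G x)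

/-- A double sum against the expanded second derivative of `χ · g`. [folklore] -/
theorem sum_sum_mul_pd_pd_mul {χ : Ed d → ℝ} {G : ℝ → ℝ} (hχ : ContDiff ℝ ∞ χ) (hG : ContDiff ℝ ∞ G)
    (A : d → d → ℝ) (x : Ed d) :
    ∑ k, ∑ l, A k l * pd (eb k) (pd (eb l) (fun y => χ y * G (phase c.η y))) x =
      (∑ k, ∑ l, A k l * c.η k * c.η l) * (χ x * deriv (deriv G) (phase c.η x)) +
        c.remTerm A χ G x := by
  have hg : ContDiff ℝ ∞ fun y => G (phase c.η y) := contDiff_comp_phase hG _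
  have hGd : Differentiable ℝ G := hG.differentiable (by simp)
  simp only [pd_pd_mul hχ hg]
  simp only [pd_pd_comp_phase hG]
  simp only [pd_comp_phase hGd, remTerm, Finset.sum_mul, ← Finset.sum_add_distrib]
  refine Finset.sum_congr rfl fun k _ => Finset.sum_congr rfl fun l _ => ?_
  simp only [EuclideanSpace.inner_single_right, one_mul, conj_trivial, phase_apply]
  ring

/-- **The cutoff expansion**: `𝓛_w̄[χ G(⟪η,·⟫)](x) = (χ(x) G''(⟪η,x⟫)) • w̄ + rem χ G x`.
[cite: ChoffrutSzekelyhidi2014, Lemma 4] -/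
theorem field_mul_comp_phase {χ : Ed d → ℝ} {G : ℝ → ℝ} (hχ : ContDiff ℝ ∞ χ) (hG : ContDiff ℝ ∞ G)
    (x : Ed d) : c.field (fun y => χ y * G (phase c.η y)) x =
      (χ x * deriv (deriv G) (phase c.η x)) • c.dir + c.rem χ G x := by
  set hval := χ x * deriv (deriv G) (phase c.η x) with hh
  have hv : ∀ i, c.velPot (fun y => χ y * G (phase c.η y)) i x = hval * c.vbar i + c.remTerm (c.P i) χ G x := by
    intro i
    unfold velPot
    rw [c.sum_sum_mul_pd_pd_mul hχ hG, c.sum_P_η_η, mul_comm]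
  have hu : ∀ i j, c.strPot (fun y => χ y * G (phase c.η y)) i j x =
      hval * (c.S i j - if i = j then c.S.trace / Fintype.card d else 0) + c.remTerm (c.Q i j) χ G x := by
    intro i j
    rw [strPot_eq_sum, c.sum_sum_mul_pd_pd_mul hχ hG]
    congr 1
    have hQ : ∑ k, ∑ l, c.Q i j k l * c.η k * c.η l =
        c.S i j - if i = j then c.S.trace / Fintype.card d else 0 := by
      unfold Q
      simp only [sub_mul, Finset.sum_sub_distrib, c.sum_Φ_η_η]
      congr 1
      split_ifs with hij
      · have e : ∀ k l, (∑ m, c.Φ m k m l) / Fintype.card d * c.η k * c.η l =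
            ∑ m, c.Φ m k m l * c.η k * c.η l / Fintype.card d := by
          intro k l
          rw [Finset.sum_div, Finset.sum_mul, Finset.sum_mul]
          exact Finset.sum_congr rfl fun m _ => by ring
        simp_rw [e]
        rw [Finset.sum_congr rfl fun k _ => Finset.sum_comm, Finset.sum_comm, Matrix.trace,
          Finset.sum_div]
        refine Finset.sum_congr rfl fun m _ => ?_
        rw [Matrix.diag_apply, ← c.sum_Φ_η_η m m, Finset.sum_div]
        refine Finset.sum_congr rfl fun k _ => ?_
        rw [Finset.sum_div]
      · simp
    rw [hQ, mul_comm]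
  refine ext_vel_str ?_ ?_
  · ext i
    rw [vel_field, hv, vel_add, vel_smul, dir, vel_mkSt, rem, vel_mkSt]
    simp [smul_eq_mul]
  · ext i j
    rw [str_field, hu, str_add, str_smul, dir, str_mkSt, rem, str_mkSt]
    simp [Matrix.sub_apply, Matrix.smul_apply, Matrix.one_apply, smul_eq_mul, mul_sub, mul_ite]

/-- **The remainder vanishes where `∇χ` and `∇²χ` vanish** (e.g. on the interior of a plateau
`{χ = 1}`): there the field is the exact plane wave. [cite: ChoffrutSzekelyhidi2014, Lemma 4] -/
theorem rem_eq_zero_of {χ : Ed d → ℝ} {G : ℝ → ℝ} {x : Ed d} (h1 : ∀ k, pd (eb k) χ x = 0)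
    (h2 : ∀ k l, pd (eb k) (pd (eb l) χ) x = 0) : c.rem χ G x = 0 := by
  have h : ∀ A : d → d → ℝ, c.remTerm A χ G x = 0 := fun A => by
    unfold remTerm; simp [h1, h2]
  ext κ; rcases κ with i | ⟨i, j⟩
  · simp [rem, h]
  · simp [rem, h]

omit [Fintype d] [DecidableEq d] in
/-- If `χ` is constant near `x` then all its first and second partial derivatives vanish at `x`.
[folklore] -/
theorem pd_eq_zero_of_eventuallyEq_const {χ : Ed d → ℝ} {x : Ed d} {a : ℝ}
    (h : χ =ᶠ[nhds x] fun _ => a) (v w : Ed d) : pd v χ x = 0 ∧ pd v (pd w χ) x = 0 := by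
  have h1 : pd w χ =ᶠ[nhds x] fun _ => (0 : ℝ) := by
    filter_upwards [h.eventually_nhds] with y hy
    rw [pd_apply, Filter.EventuallyEq.fderiv_eq (show χ =ᶠ[nhds y] fun _ => a from hy),
      fderiv_const_apply]
    rfl
  refine ⟨?_, ?_⟩
  · rw [pd_apply, h.fderiv_eq, fderiv_const_apply]; rfl
  · rw [pd_apply, h1.fderiv_eq, fderiv_const_apply]; rfl

/-- A crude uniform bound for the coefficient arrays of the certificate. [folklore] -/
def coefBound : ℝ := ∑ i, ∑ k, ∑ l, |c.P i k l| + ∑ i, ∑ j, ∑ k, ∑ l, |c.Q i j k l|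

/-- A single remainder sum is bounded through bounds on `∇χ`, `∇²χ`, `G`, `G'`. [folklore] -/
theorem abs_remTerm_le [Nonempty d] (A : d → d → ℝ) {χ : Ed d → ℝ} {G : ℝ → ℝ} {x : Ed d} {M₁ M₂ B₀ B₁ : ℝ}
    (hM₁ : ∀ k, |pd (eb k) χ x| ≤ M₁) (hM₂ : ∀ k l, |pd (eb k) (pd (eb l) χ) x| ≤ M₂)
    (hB₀ : |G (phase c.η x)| ≤ B₀) (hB₁ : |deriv G (phase c.η x)| ≤ B₁) :
    |c.remTerm A χ G x| ≤ (∑ k, ∑ l, |A k l|) * (M₂ * B₀ + 2 * (M₁ * ‖c.η‖) * B₁) := by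
  have hη : ∀ k, |c.η k| ≤ ‖c.η‖ := fun k => by
    simpa [Real.norm_eq_abs] using PiLp.norm_apply_le (p := 2) c.η k
  have hM₁' : 0 ≤ M₁ := (abs_nonneg _).trans (hM₁ (Classical.arbitrary d))
  unfold remTerm
  rw [Finset.sum_mul]
  refine (Finset.abs_sum_le_sum_abs _ _).trans (Finset.sum_le_sum fun k _ => ?_)
  rw [Finset.sum_mul]
  refine (Finset.abs_sum_le_sum_abs _ _).trans (Finset.sum_le_sum fun l _ => ?_)
  rw [abs_mul]
  refine mul_le_mul_of_nonneg_left ?_ (abs_nonneg _)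
  calc |pd (eb k) (pd (eb l) χ) x * G (phase c.η x) +
        (pd (eb l) χ x * c.η k + pd (eb k) χ x * c.η l) * deriv G (phase c.η x)|
      ≤ |pd (eb k) (pd (eb l) χ) x| * |G (phase c.η x)| +
        (|pd (eb l) χ x| * |c.η k| + |pd (eb k) χ x| * |c.η l|) * |deriv G (phase c.η x)| := by
        refine (abs_add_le _ _).trans (add_le_add (le_of_eq (abs_mul _ _)) ?_)
        rw [abs_mul]
        gcongr
        exact (abs_add_le _ _).trans (le_of_eq (by rw [abs_mul, abs_mul]))
    _ ≤ M₂ * B₀ + (M₁ * ‖c.η‖ + M₁ * ‖c.η‖) * B₁ := by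
        have hn : 0 ≤ M₁ * ‖c.η‖ + M₁ * ‖c.η‖ :=
          add_nonneg (mul_nonneg hM₁' (norm_nonneg _)) (mul_nonneg hM₁' (norm_nonneg _))
        refine add_le_add (mul_le_mul (hM₂ k l) hB₀ (abs_nonneg _) ((abs_nonneg _).trans (hM₂ k l)))
          (mul_le_mul ?_ hB₁ (abs_nonneg _) hn)
        exact add_le_add (mul_le_mul (hM₁ l) (hη k) (abs_nonneg _) hM₁')
          (mul_le_mul (hM₁ k) (hη l) (abs_nonneg _) hM₁')
    _ = M₂ * B₀ + 2 * (M₁ * ‖c.η‖) * B₁ := by ring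

/-- **Bound on the remainder**: `‖rem χ G x‖ ≤ C_w̄ (M₂ |G| + 2 M₁ |η| |G'|)`.
[cite: ChoffrutSzekelyhidi2014, Lemma 4] -/
theorem norm_rem_le [Nonempty d] {χ : Ed d → ℝ} {G : ℝ → ℝ} {x : Ed d} {M₁ M₂ B₀ B₁ : ℝ}
    (hM₁ : ∀ k, |pd (eb k) χ x| ≤ M₁) (hM₂ : ∀ k l, |pd (eb k) (pd (eb l) χ) x| ≤ M₂)
    (hB₀ : |G (phase c.η x)| ≤ B₀) (hB₁ : |deriv G (phase c.η x)| ≤ B₁) :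
    ‖c.rem χ G x‖ ≤ c.coefBound * (M₂ * B₀ + 2 * (M₁ * ‖c.η‖) * B₁) := by
  have hX : 0 ≤ M₂ * B₀ + 2 * (M₁ * ‖c.η‖) * B₁ := by
    have i0 := Classical.arbitrary d
    have hM₁' : 0 ≤ M₁ := (abs_nonneg _).trans (hM₁ i0)
    have hM₂' : 0 ≤ M₂ := (abs_nonneg _).trans (hM₂ i0 i0)
    have hB₀' : 0 ≤ B₀ := (abs_nonneg _).trans hB₀
    have hB₁' : 0 ≤ B₁ := (abs_nonneg _).trans hB₁
    positivity
  refine (norm_le_sum_abs _).trans ?_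
  rw [Fintype.sum_sum_type, coefBound, add_mul, Finset.sum_mul, Finset.sum_mul]
  refine add_le_add (Finset.sum_le_sum fun i _ => ?_) ?_
  · exact c.abs_remTerm_le (c.P i) hM₁ hM₂ hB₀ hB₁
  · rw [Fintype.sum_prod_type]
    refine Finset.sum_le_sum fun i _ => ?_
    rw [Finset.sum_mul]
    exact Finset.sum_le_sum fun j _ => c.abs_remTerm_le (c.Q i j) hM₁ hM₂ hB₀ hB₁

end WaveCert

/-! ## Wave packets -/

variable (d) in
/-- A localized plane wave: a certificate and a smooth compactly supported potential.
[cite: ChoffrutSzekelyhidi2014, Lemma 4] -/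
structure WaveTerm where
  /-- the certified direction -/
  cert : WaveCert d
  /-- the scalar potential -/
  φ : Ed d → ℝ
  smooth : ContDiff ℝ ∞ φ
  cpt : HasCompactSupport φ

namespace WaveTerm

/-- The field of a term. [folklore] -/
def field (τ : WaveTerm d) : Ed d → State d := τ.cert.field τ.φ

/-- The field of a term is smooth. [folklore] -/
theorem contDiff_field (τ : WaveTerm d) : ContDiff ℝ ∞ τ.field := τ.cert.contDiff_field τ.smooth

/-- The field of a term has compact support. [folklore] -/
theorem hasCompactSupport_field (τ : WaveTerm d) : HasCompactSupport τ.field :=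
  τ.cert.hasCompactSupport_field τ.cpt

/-- The field of a term is integrable. [folklore] -/
theorem integrable_field (τ : WaveTerm d) : Integrable τ.field :=
  τ.contDiff_field.continuous.integrable_of_hasCompactSupport τ.hasCompactSupport_field

/-- The field of a term has integral zero. [folklore] -/
theorem integral_field (τ : WaveTerm d) : ∫ x, τ.field x = 0 := τ.cert.integral_field τ.smooth τ.cpt

/-- Rescaling a term. [folklore] -/
def rescale (x₀ : Ed d) (s : ℝ) (hs : s ≠ 0) (τ : WaveTerm d) : WaveTerm d where
  cert := τ.cert
  φ := WaveCert.rescale x₀ s τ.φ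
  smooth := WaveCert.contDiff_rescale τ.smooth x₀ s
  cpt := WaveCert.hasCompactSupport_rescale τ.cpt x₀ hs

/-- Field of a rescaled term. [folklore] -/
theorem field_rescale (x₀ : Ed d) {s : ℝ} (hs : s ≠ 0) (τ : WaveTerm d) (x : Ed d) :
    (τ.rescale x₀ s hs).field x = τ.field (s⁻¹ • (x - x₀)) :=
  τ.cert.field_rescale τ.smooth x₀ hs x

end WaveTerm

variable (d) in
/-- A wave packet: a finite list of localized plane waves. [cite: ChoffrutSzekelyhidi2014, Prop. 6] -/
abbrev Packet : Type _ := List (WaveTerm d)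

namespace Packet

/-- The field of a packet: the sum of the fields of its terms. [cite: ChoffrutSzekelyhidi2014, Prop. 6] -/
def field (P : Packet d) (x : Ed d) : State d := (P.map fun τ => τ.field x).sum

/-- Field of the empty packet. [folklore] -/
@[simp] theorem field_nil (x : Ed d) : field ([] : Packet d) x = 0 := rfl

/-- Field of a packet with a new head. [folklore] -/
@[simp] theorem field_cons (τ : WaveTerm d) (P : Packet d) (x : Ed d) :
    field (τ :: P) x = τ.field x + field P x := rfl

/-- Field of a concatenation. [folklore] -/
@[simp] theorem field_append (P P' : Packet d) (x : Ed d) : field (P ++ P') x = field P x + field P' x := by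
  simp [field, List.map_append, List.sum_append]

/-- The field of a packet is smooth. [folklore] -/
theorem contDiff_field (P : Packet d) : ContDiff ℝ ∞ (field P) := by
  induction P with
  | nil => exact contDiff_const
  | cons τ P ih =>
    show ContDiff ℝ ∞ (fun x => τ.field x + field P x)
    exact τ.contDiff_field.add ih

/-- The field of a packet is continuous. [folklore] -/
theorem continuous_field (P : Packet d) : Continuous (field P) := (contDiff_field P).continuous

/-- All potentials of the packet are supported in `B`. [folklore] -/
def SuppIn (B : Set (Ed d)) (P : Packet d) : Prop := ∀ τ ∈ P, tsupport τ.φ ⊆ B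

omit [DecidableEq d] in
/-- `SuppIn` is monotone. [folklore] -/
theorem SuppIn.mono {B B' : Set (Ed d)} {P : Packet d} (h : SuppIn B P) (hBB' : B ⊆ B') : SuppIn B' P :=
  fun τ hτ => (h τ hτ).trans hBB'

omit [DecidableEq d] in
/-- `SuppIn` of a concatenation. [folklore] -/
theorem suppIn_append {B : Set (Ed d)} {P P' : Packet d} : SuppIn B (P ++ P') ↔ SuppIn B P ∧ SuppIn B P' := by
  simp only [SuppIn, List.mem_append]
  exact ⟨fun h => ⟨fun τ hτ => h τ (Or.inl hτ), fun τ hτ => h τ (Or.inr hτ)⟩,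
    fun h τ hτ => hτ.elim (h.1 τ) (h.2 τ)⟩

/-- The field of a packet vanishes off the union of the supports of its potentials. [folklore] -/
theorem field_eq_zero_of_forall {P : Packet d} {x : Ed d} (hx : ∀ τ ∈ P, x ∉ tsupport τ.φ) :
    field P x = 0 := by
  induction P with
  | nil => rfl
  | cons τ P ih =>
    rw [field_cons, ih fun τ' hτ' => hx τ' (List.mem_cons_of_mem _ hτ'), add_zero]
    exact τ.cert.field_eq_zero_of_notMem (hx τ List.mem_cons_self)

/-- A packet supported in `B` has field vanishing off `B`. [folklore] -/
theorem field_eq_zero_of_suppIn {B : Set (Ed d)} {P : Packet d} (hP : SuppIn B P) {x : Ed d}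
    (hx : x ∉ B) : field P x = 0 :=
  field_eq_zero_of_forall fun τ hτ h => hx (hP τ hτ h)

/-- The support of the field of a packet supported in `B` lies in the closure of `B`. [folklore] -/
theorem tsupport_field_subset {B : Set (Ed d)} {P : Packet d} (hP : SuppIn B P) :
    tsupport (field P) ⊆ closure B :=
  closure_mono fun _ hx => by_contra fun h => hx (field_eq_zero_of_suppIn hP h)

/-- The field of a packet has compact support. [folklore] -/
theorem hasCompactSupport_field (P : Packet d) : HasCompactSupport (field P) := by
  induction P with
  | nil => exact HasCompactSupport.zero
  | cons τ P ih => exact τ.hasCompactSupport_field.add ih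

/-- The field of a packet is integrable. [folklore] -/
theorem integrable_field (P : Packet d) : Integrable (field P) :=
  (continuous_field P).integrable_of_hasCompactSupport (hasCompactSupport_field P)

/-- **The field of a packet has integral zero.** [cite: ChoffrutSzekelyhidi2014, Lemma 3] -/
theorem integral_field (P : Packet d) : ∫ x, field P x = 0 := by
  induction P with
  | nil => simp
  | cons τ P ih =>
    simp only [field_cons]
    rw [integral_add τ.integrable_field (integrable_field P), ih, add_zero, τ.integral_field]

/-- The values of the field of a packet are admissible. [cite: ChoffrutSzekelyhidi2014, Lemma 3] -/
theorem isAdm_field [Nonempty d] (P : Packet d) (x : Ed d) : IsAdm (field P x) := by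
  induction P with
  | nil => exact isAdm_zero
  | cons τ P ih => rw [field_cons]; exact (τ.cert.isAdm_field τ.smooth x).add ih

/-- Rescaling a packet. [folklore] -/
def rescale (x₀ : Ed d) (s : ℝ) (hs : s ≠ 0) (P : Packet d) : Packet d := P.map (WaveTerm.rescale x₀ s hs)

/-- **Field of a rescaled packet**: `field (rescale x₀ s P) x = field P ((x - x₀)/s)`. [folklore] -/
theorem field_rescale (x₀ : Ed d) {s : ℝ} (hs : s ≠ 0) (P : Packet d) (x : Ed d) :
    field (rescale x₀ s hs P) x = field P (s⁻¹ • (x - x₀)) := by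
  induction P with
  | nil => rfl
  | cons τ P ih =>
    simp only [rescale, List.map_cons, field_cons] at ih ⊢
    rw [ih, WaveTerm.field_rescale]

omit [DecidableEq d] in
/-- Supports of a rescaled packet. [folklore] -/
theorem suppIn_rescale {B : Set (Ed d)} {P : Packet d} (hP : SuppIn B P) (x₀ : Ed d) {s : ℝ}
    (hs : s ≠ 0) : SuppIn ((fun y => x₀ + s • y) '' B) (rescale x₀ s hs P) := by
  intro τ hτ
  obtain ⟨τ₀, hτ₀, rfl⟩ := List.mem_map.1 hτ
  exact (WaveCert.tsupport_rescale_subset _ x₀ hs).trans (image_mono (hP τ₀ hτ₀))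

end Packet

end StationaryEuler

end Literature.Analysis.FluidPDE
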